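import Summits.CriticalPhenomena.CardyFormulaZ2.Theorems.CardyBoundaryCoulombGasRectilinearCardyRowDefs
import Summits.CriticalPhenomena.CardyFormulaZ2.Theorems.RectilinearCardy.Negative.RectilinearCardyReductions
import Literature.Probability.LatticeModels.BoundaryNormalisedPoissonKernelLimitProofs
import Literature.Probability.LatticeModels.FlatBoundaryLatticeWindow
import Literature.Analysis.Complex.DerivNeZeroOfHalfDisc
import HarnessLib

/-!
# Stub `stub_kernelPointAsymptotics` of line `excursion-kernel-covariance`, part 1: the boundary row
# at a flat boundary point (crux `RectilinearCardy`, stmt-CriticalPhenomena-5660, route `CardyBoundaryCoulombGas`)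

Lattice geometry behind the uniform point asymptotics of the cube-root weight `rowWeight` on the
closure discretisation `V_δ = closureFinset R δ` of a rectilinear conformal rectangle `R`:

* `kpa_exists_rowVertex_of_orient` — at a boundary point `x` near which `D̄ ∩ B(x, r)` is the closed
  half-disc `{nrmC o x ≤ nrmC o}` (orientation `o`, the tree's `Orient`), for every mesh `δ` with
  `4δ ≤ r` the first lattice point of `D̄` on the lattice line normal to the edge through the column
  nearest to `x` lies in `V = {v : δ v ∈ D̄}`, has exactly one lattice neighbour outside `V` (the
  one across the edge) and is within `2δ` of `x`;
* `kpa_exists_mem_boundaryRow_dist_lt` — hence at a FLAT boundary point of `R` (`FlatNear`; the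
  one-sided local structure is the tree's `exists_orient_of_flat`, resting on the Jordan curve
  theorem) the boundary row `boundaryRow R δ` has a vertex within `2δ`, for all small `δ`;
* `kpa_markRow_spec`, `kpa_eventually_markRow` — so the pole representative `markRow R δ i` of a flat mark
  `pt i` is a genuine boundary-row vertex within `2δ` of `pt i`, eventually as `δ → 0⁺`;
* `kpa_eventually_nearestSite_mem_closureFinset` — the nearest site to an interior reference point lies
  in `V_δ` eventually.

All [folklore] (lattice bookkeeping; cf. Chelkak–Smirnov, Adv. Math. 228 (2011), §3.5 for the setting).
-/

noncomputable section

open Set Filter Topology Metric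
open Literature.Probability.RandomPlanarGeometry
open Literature.Probability.LatticeModels (Site meshPoint meshVertices meshVertices_finite dirichletGreen
  zdGraph nearestSite dist_meshPoint_nearestSite_le Orient exists_orient_of_flat cornerUnit
  dist_meshPoint_add_cornerUnit)
open Summit.CriticalPhenomena.CardyFormulaZ2.Theorems.RectilinearCardy.Negative (IsRectilinear)

namespace Summit.CriticalPhenomena.CardyFormulaZ2.Cruxes.RectilinearCardy.ExcursionKernelCovariance

/-! ### A boundary-row vertex at an oriented flat boundary point -/

/-- Distance from a mesh point to `x` is at most the sum of the tangential and normal offsets in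
the orientation `o`. [folklore] -/
theorem kpa_dist_meshPoint_le_tng_add_nrm (o : Orient) (δ : ℝ) (u : Site 2) (x : ℂ) :
    dist (meshPoint δ u) x ≤
      |δ * (Orient.tng o u : ℝ) - Orient.tngC o x| + |δ * (Orient.nrm o u : ℝ) - Orient.nrmC o x| := by
  rw [dist_eq_norm]
  have h := Orient.norm_le_abs_tngC_add_abs_nrmC o (meshPoint δ u - x)
  rwa [Orient.tngC_sub, Orient.nrmC_sub, Orient.tngC_meshPoint, Orient.nrmC_meshPoint] at h

/-- **A boundary-row vertex at an oriented flat boundary point.** If inside `B(x, r)` membership in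
`D̄` is `nrmC o x ≤ nrmC o z`, `V = {v : meshPoint δ v ∈ D̄}` and `0 < 4δ ≤ r`, then some `v ∈ V`
within `2δ` of `x` has exactly one lattice neighbour outside `V`: the lattice point with tangential
coordinate `round(tngC o x/δ)` and normal coordinate `⌈nrmC o x/δ⌉` (its neighbour across the edge is
outside, the other three are inside). [folklore] -/
theorem kpa_exists_rowVertex_of_orient (o : Orient) {D : Set ℂ} {x : ℂ} {r δ : ℝ} (hδ : 0 < δ)
    (hδr : 4 * δ ≤ r) {V : Finset (Site 2)}
    (hV : ∀ v : Site 2, v ∈ V ↔ meshPoint δ v ∈ closure D)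
    (hstruct : ∀ z, dist z x < r → (z ∈ closure D ↔ Orient.nrmC o x ≤ Orient.nrmC o z)) :
    ∃ v : Site 2, v ∈ V ∧ (((zdGraph 2).neighborFinset v).filter (fun u => u ∉ V)).card = 1 ∧
      dist (meshPoint δ v) x < 2 * δ := by
  classical
  set t : ℤ := round (Orient.tngC o x / δ) with ht
  set m : ℤ := ⌈Orient.nrmC o x / δ⌉ with hm
  -- the rounding estimates
  have htng : |δ * (t : ℝ) - Orient.tngC o x| ≤ δ / 2 := by
    have h := abs_sub_round (Orient.tngC o x / δ)
    have : δ * (t : ℝ) - Orient.tngC o x = -(δ * (Orient.tngC o x / δ - round (Orient.tngC o x / δ))) := by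
      rw [ht]; field_simp; ring
    rw [this, abs_neg, abs_mul, abs_of_pos hδ]
    nlinarith
  have hm1 : Orient.nrmC o x ≤ δ * (m : ℝ) := by
    have h := Int.le_ceil (Orient.nrmC o x / δ)
    rw [← hm, div_le_iff₀ hδ] at h
    linarith
  have hm2 : δ * ((m : ℝ) - 1) < Orient.nrmC o x := by
    have h := Int.ceil_lt_add_one (Orient.nrmC o x / δ)
    rw [← hm] at h
    have h' : (m : ℝ) - 1 < Orient.nrmC o x / δ := by linarith
    rw [lt_div_iff₀ hδ] at h'
    linarith
  -- the vertex and its frame coordinates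
  set v : Site 2 := (Orient.frame o).symm ![t, m] with hv
  have hfv : Orient.frame o v = ![t, m] := by rw [hv, Equiv.apply_symm_apply]
  have htv : Orient.tng o v = t := by rw [← Orient.frame_apply_zero, hfv]; rfl
  have hnv : Orient.nrm o v = m := by rw [← Orient.frame_apply_one, hfv]; rfl
  have hdv : dist (meshPoint δ v) x < 2 * δ := by
    have h := kpa_dist_meshPoint_le_tng_add_nrm o δ v x
    rw [htv, hnv] at h
    have h2 : |δ * (m : ℝ) - Orient.nrmC o x| < δ := by
      rw [abs_of_nonneg (by linarith)]; linarith
    linarith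
  -- membership near `x` is decided by the normal coordinate
  have hmem : ∀ u : Site 2, dist (meshPoint δ u) x < r →
      (u ∈ V ↔ Orient.nrmC o x ≤ δ * (Orient.nrm o u : ℝ)) := by
    intro u hu
    rw [hV, hstruct _ hu, Orient.nrmC_meshPoint]
  have hvV : v ∈ V := (hmem v (by linarith)).2 (by rw [hnv]; exact hm1)
  -- the lattice motion `frame o` permutes the four unit steps
  obtain ⟨perm, hperm⟩ := Orient.isLatticeMotion_frame o
  have hnrm_step : ∀ k : Fin 4, (Orient.nrm o (v + cornerUnit k) : ℝ) = m + (cornerUnit (perm k) 1 : ℤ) := by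
    intro k
    rw [← Orient.frame_apply_one, hperm v k, hfv]
    push_cast
    simp
  have hdist_step : ∀ k : Fin 4, dist (meshPoint δ (v + cornerUnit k)) x < r := by
    intro k
    calc dist (meshPoint δ (v + cornerUnit k)) x
        ≤ dist (meshPoint δ (v + cornerUnit k)) (meshPoint δ v) + dist (meshPoint δ v) x :=
          dist_triangle _ _ _
      _ = δ + dist (meshPoint δ v) x := by rw [dist_meshPoint_add_cornerUnit hδ]
      _ < r := by linarith
  -- the outside neighbour: the step sent to "south" by the frame
  set k₀ : Fin 4 := perm.symm 3 with hk₀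
  have hk₀' : perm k₀ = 3 := by rw [hk₀, Equiv.apply_symm_apply]
  have hout : v + cornerUnit k₀ ∉ V := by
    rw [hmem _ (hdist_step k₀), hnrm_step k₀, hk₀', not_le]
    have : ((cornerUnit 3 1 : ℤ) : ℝ) = -1 := by simp [cornerUnit]
    rw [this]; linarith
  have hin : ∀ k : Fin 4, k ≠ k₀ → v + cornerUnit k ∈ V := by
    intro k hk
    rw [hmem _ (hdist_step k), hnrm_step k]
    have hk' : perm k ≠ 3 := fun h => hk (by rw [hk₀, ← h, Equiv.symm_apply_apply])
    have hc : (0 : ℤ) ≤ cornerUnit (perm k) 1 := by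
      generalize perm k = k' at hk' ⊢
      fin_cases k' <;> simp [cornerUnit] at hk' ⊢
    have hc' : (0 : ℝ) ≤ ((cornerUnit (perm k) 1 : ℤ) : ℝ) := by exact_mod_cast hc
    rw [mul_add]
    linarith [mul_nonneg hδ.le hc']
  refine ⟨v, hvV, ?_, hdv⟩
  rw [Finset.card_eq_one]
  refine ⟨v + cornerUnit k₀, Finset.ext fun u => ?_⟩
  rw [Finset.mem_filter, SimpleGraph.mem_neighborFinset, Finset.mem_singleton]
  constructor
  · rintro ⟨hadj, huV⟩
    obtain ⟨k, rfl⟩ := Literature.Probability.LatticeModels.WeakBeurling.exists_eq_add_cornerUnit_of_adj hadj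
    by_contra hne
    exact huV (hin k fun h => hne (by rw [h]))
  · rintro rfl
    exact ⟨Literature.Probability.Percolation.adj_of_stepKind
      (Literature.Probability.LatticeModels.WeakBeurling.stepKind_add_cornerUnit v k₀), hout⟩

/-! ### The boundary row of `V_δ` near flat boundary points of `R` -/

/-- **The boundary row near a flat boundary point.** At a flat boundary point `x` of the conformal
rectangle `R` (`FlatNear R x r`), for every mesh `0 < δ` with `4δ ≤ r` the boundary row of the
closure discretisation has a vertex within `2δ` of `x` (one-sidedness of `Ω` at `x` is the tree's
`exists_orient_of_flat`, from the Jordan curve theorem). [folklore] -/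
theorem kpa_exists_mem_boundaryRow_dist_lt (R : ConformalRectangle) {x : ℂ} (hx : x ∈ frontier R.carrier)
    {r : ℝ} (hr : 0 < r) (hflat : FlatNear R x r) {δ : ℝ} (hδ : 0 < δ) (hδr : 4 * δ ≤ r) :
    ∃ v ∈ boundaryRow R δ, dist (meshPoint δ v) x < 2 * δ := by
  obtain ⟨o, hsx, -⟩ := exists_orient_of_flat R.toJordanDomain hx hr hflat
  obtain ⟨v, hvV, hcard, hdist⟩ := kpa_exists_rowVertex_of_orient o hδ hδr
    (fun v => mem_closureFinset_iff R hδ) hsx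
  exact ⟨v, (mem_boundaryRow_iff R).2 ⟨hvV, hcard⟩, hdist⟩

/-- **Specification of `markRow`.** If the boundary row is nonempty, `markRow R δ i` is a boundary-row
vertex minimising the distance of its mesh point to the mark `pt i` (Hilbert `ε` of a satisfiable
predicate: a finite nonempty set has a distance minimiser). [folklore] -/
theorem kpa_markRow_spec (R : ConformalRectangle) {δ : ℝ} (i : Fin 4) (hne : (boundaryRow R δ).Nonempty) :
    markRow R δ i ∈ boundaryRow R δ ∧
      ∀ y ∈ boundaryRow R δ, dist (meshPoint δ (markRow R δ i)) (R.pt i) ≤ dist (meshPoint δ y) (R.pt i) := by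
  obtain ⟨x, hx, hmin⟩ :=
    Finset.exists_min_image (boundaryRow R δ) (fun y => dist (meshPoint δ y) (R.pt i)) hne
  unfold markRow
  exact Classical.epsilon_spec (p := fun x : Site 2 => x ∈ boundaryRow R δ ∧
    ∀ y ∈ boundaryRow R δ, dist (meshPoint δ x) (R.pt i) ≤ dist (meshPoint δ y) (R.pt i)) ⟨x, hx, hmin⟩

/-- **The pole representative of a flat mark is a nearby boundary-row vertex**: if `pt i` is flat at
radius `r` and `0 < 4δ ≤ r`, then `markRow R δ i ∈ boundaryRow R δ` and its mesh point is within `2δ`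
of `pt i`. [folklore] -/
theorem kpa_markRow_mem_and_dist_lt (R : ConformalRectangle) (i : Fin 4) {r : ℝ} (hr : 0 < r)
    (hflat : FlatNear R (R.pt i) r) {δ : ℝ} (hδ : 0 < δ) (hδr : 4 * δ ≤ r) :
    markRow R δ i ∈ boundaryRow R δ ∧ dist (meshPoint δ (markRow R δ i)) (R.pt i) < 2 * δ := by
  obtain ⟨v, hv, hdist⟩ := kpa_exists_mem_boundaryRow_dist_lt R (R.pt_mem_frontier i) hr hflat hδ hδr
  obtain ⟨hmem, hmin⟩ := kpa_markRow_spec R i ⟨v, hv⟩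
  exact ⟨hmem, (hmin v hv).trans_lt hdist⟩

/-- **Eventually all pole representatives are good.** If every mark of `R` is flat, then for all
small `δ > 0` each `markRow R δ i` is a boundary-row vertex within `2δ` of `pt i`. [folklore] -/
theorem kpa_eventually_markRow (R : ConformalRectangle)
    (hfl : ∀ i : Fin 4, ∃ r : ℝ, 0 < r ∧ FlatNear R (R.pt i) r) :
    ∀ᶠ δ in 𝓝[>] (0 : ℝ), ∀ i : Fin 4,
      markRow R δ i ∈ boundaryRow R δ ∧ dist (meshPoint δ (markRow R δ i)) (R.pt i) < 2 * δ := by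
  rw [Filter.eventually_all]
  intro i
  obtain ⟨r, hr, hflat⟩ := hfl i
  filter_upwards [Ioo_mem_nhdsGT (show (0 : ℝ) < r / 4 by positivity)] with δ hδ
  exact kpa_markRow_mem_and_dist_lt R i hr hflat hδ.1 (by linarith [hδ.2])

/-- **The reference site.** For an interior point `u₀ ∈ Ω`, the nearest site `nearestSite δ u₀` lies
in the closure discretisation `V_δ` for all small `δ > 0` (its mesh point is within `δ` of `u₀`).
[folklore] -/
theorem kpa_eventually_nearestSite_mem_closureFinset (R : ConformalRectangle) {u₀ : ℂ}
    (hu₀ : u₀ ∈ R.carrier) : ∀ᶠ δ in 𝓝[>] (0 : ℝ), nearestSite δ u₀ ∈ closureFinset R δ := by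
  obtain ⟨ρ, hρ, hball⟩ := Metric.isOpen_iff.1 R.isOpen u₀ hu₀
  filter_upwards [Ioo_mem_nhdsGT hρ] with δ hδ
  rw [mem_closureFinset_iff R hδ.1]
  exact subset_closure (hball (mem_ball.2 ((dist_meshPoint_nearestSite_le hδ.1 u₀).trans_lt hδ.2)))

/-! ### Convergence of mesh points along a sequence of meshes -/

/-- Points within `C δ_n` of a convergent sequence converge to the same limit when `δ_n → 0`.
[folklore] -/
theorem kpa_tendsto_of_dist_le_mul {δ : ℕ → ℝ} (hδ0 : Tendsto δ atTop (𝓝 0)) {p q : ℕ → ℂ} {z : ℂ}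
    (C : ℝ) (hq : Tendsto q atTop (𝓝 z)) (hd : ∀ n, dist (p n) (q n) ≤ C * δ n) :
    Tendsto p atTop (𝓝 z) := by
  rw [tendsto_iff_dist_tendsto_zero] at hq ⊢
  have hlim : Tendsto (fun n => C * δ n + dist (q n) z) atTop (𝓝 0) := by
    have := (hδ0.const_mul C).add hq
    simpa using this
  exact squeeze_zero (fun n => dist_nonneg) (fun n => (dist_triangle (p n) (q n) z).trans (by
    linarith [hd n])) hlim

/-- The mesh points of the pole representatives converge to the marks along meshes `δ_n → 0`.
[folklore] -/
theorem kpa_tendsto_meshPoint_markRow (R : ConformalRectangle) {δ : ℕ → ℝ} (hδ0 : Tendsto δ atTop (𝓝 0))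
    (i : Fin 4) (hm : ∀ n, dist (meshPoint (δ n) (markRow R (δ n) i)) (R.pt i) < 2 * δ n) :
    Tendsto (fun n => meshPoint (δ n) (markRow R (δ n) i)) atTop (𝓝 (R.pt i)) :=
  kpa_tendsto_of_dist_le_mul hδ0 2 tendsto_const_nhds fun n => (hm n).le

/-- The mesh points of the reference sites converge to the reference point along meshes
`δ_n → 0⁺`. [folklore] -/
theorem kpa_tendsto_meshPoint_nearestSite {δ : ℕ → ℝ} (hδ : ∀ n, 0 < δ n) (hδ0 : Tendsto δ atTop (𝓝 0))
    (u₀ : ℂ) : Tendsto (fun n => meshPoint (δ n) (nearestSite (δ n) u₀)) atTop (𝓝 u₀) :=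
  kpa_tendsto_of_dist_le_mul hδ0 1 tendsto_const_nhds fun n => by
    rw [one_mul]; exact dist_meshPoint_nearestSite_le (hδ n) u₀

end Summit.CriticalPhenomena.CardyFormulaZ2.Cruxes.RectilinearCardy.ExcursionKernelCovariance

end
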